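import Summits.QuantumFields.YangMills.Theorems.PoincareLipschitzSobolevInversionConformal
import Mathlib.MeasureTheory.Function.L2Space
import HarnessLib

/-!
# The removable pole for the Sobolev transport under the planar inversion (ROAD (W), brick W-INV, part 4)

Helper file (K2 lane of crux `stmt-QuantumFields-19936` `HistoryTailL` ∕ crux `stmt-QuantumFields-23533`
`BlockLipschitzL`, LINE 25 «CompactnessTransfer», ROAD (W) «the H-system energy gap at `3π` from the
sharp two-point Wente bound», brick W-INV).  YM₃ on the unit 3-torus is rung R3 of the ladder — NOT
`d = 4`, NOT infinite volume, NOT a mass gap, NOT the Clay problem; nothing here bears on those.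

Points have zero `W^{1,2}`-capacity in the plane.  Concretely (`E² = EuclideanSpace ℝ (Fin 2)`,
`e k = EuclideanSpace.single k 1`):

* §1 shrinking smooth cut-offs at `c` (one Mathlib `ContDiffBump`, rescaled: `= 1` on `B̄(c, ε)`, `= 0`
  off `B(c, 2ε)`, `‖Dχ‖ ≤ K ∕ ε`) and two vanishing lemmas along the balls `B(c, r₀/(n+1))`:
  `∫ κ_n · g → 0` for `|κ_n| ≤ C` supported in the `n`-th ball and `g ∈ L¹(B(c, r₀))`
  (`tendsto_integral_cutoff_mul`), and `∫ κ_n · h → 0` for `|κ_n| ≤ C (n+1)/r₀` and `h ∈ L²(B(c, r₀))`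
  (`tendsto_integral_cutoffDeriv_mul`: Cauchy–Schwarz, `‖κ_n‖_{L²} ≤ C |B(0,1)|^{1/2}` uniformly — the
  planar scale invariance);
* §2 small letters for part 5 (the extension across the pole): `‖L‖ ≤ Σ_k |L e_k|`, integrability
  on a ball from the energy, and «test function × (1 − cut-off) is a test function off the pole».

References: H. Brezis, J.-M. Coron, Arch. Rational Mech. Anal. 89 (1985), Appendix p. 48 («a standard
argument leads to `ω̃ ∈ H¹_loc(ℝ²)` and the equation in `𝒟′(ℝ²)`»); L. C. Evans, *PDE* (2010), §5.2.1.
-/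

noncomputable section

open MeasureTheory Set Filter Metric Module EuclideanGeometry TopologicalSpace
open scoped ENNReal Topology RealInnerProductSpace ContDiff

namespace Summit.QuantumFields.YangMills.Theorems.PoincareLipschitzSobolevInversion

open Literature.Analysis.FunctionSpaces

/-! ## §1 Shrinking cut-offs and the two vanishing lemmas -/

/-- **Shrinking smooth cut-offs at a point with the planar derivative bound**: there is `K ≥ 0` such
that for every `ε > 0` there is a smooth `χ` with `0 ≤ χ ≤ 1`, `χ = 1` on `closedBall c ε`, `χ = 0`
off `ball c (2ε)`, and `‖Dχ(y)‖ ≤ K ∕ ε` (one fixed `ContDiffBump`, rescaled). [folklore] -/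
theorem exists_cutoff_family (c : EuclideanSpace ℝ (Fin 2)) :
    ∃ K : ℝ, 0 ≤ K ∧ ∀ ε : ℝ, 0 < ε → ∃ χ : EuclideanSpace ℝ (Fin 2) → ℝ, ContDiff ℝ ∞ χ ∧
      (∀ y, 0 ≤ χ y ∧ χ y ≤ 1) ∧ (∀ y, dist y c ≤ ε → χ y = 1) ∧ (∀ y, 2 * ε ≤ dist y c → χ y = 0) ∧
      ∀ y, ‖fderiv ℝ χ y‖ ≤ K / ε := by
  let b : ContDiffBump (0 : EuclideanSpace ℝ (Fin 2)) := ⟨1, 2, one_pos, one_lt_two⟩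
  have hbd : Continuous (fderiv ℝ (b : EuclideanSpace ℝ (Fin 2) → ℝ)) :=
    (b.contDiff (n := 1)).continuous_fderiv one_ne_zero
  obtain ⟨K, hK⟩ := hbd.bounded_above_of_compact_support (b.hasCompactSupport.fderiv (𝕜 := ℝ))
  have hK0 : 0 ≤ K := (norm_nonneg _).trans (hK 0)
  refine ⟨K, hK0, fun ε hε => ?_⟩
  refine ⟨fun y => b (ε⁻¹ • (y - c)), ?_, fun y => ⟨b.nonneg, b.le_one⟩, fun y hy => ?_,
    fun y hy => ?_, fun y => ?_⟩
  · exact b.contDiff.comp ((contDiff_id.sub contDiff_const).const_smul _)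
  · refine b.one_of_mem_closedBall ?_
    rw [mem_closedBall, dist_zero_right, norm_smul, norm_inv, Real.norm_of_nonneg hε.le, ← dist_eq_norm]
    rw [inv_mul_le_iff₀ hε]
    show dist y c ≤ ε * b.rIn
    have : b.rIn = 1 := rfl
    rw [this, mul_one]; exact hy
  · refine b.zero_of_le_dist ?_
    rw [dist_zero_right, norm_smul, norm_inv, Real.norm_of_nonneg hε.le, ← dist_eq_norm]
    rw [le_inv_mul_iff₀ hε]
    show ε * b.rOut ≤ dist y c
    have : b.rOut = 2 := rfl
    rw [this]; linarith
  · have h1 : HasFDerivAt (fun y : EuclideanSpace ℝ (Fin 2) => ε⁻¹ • (y - c))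
        (ε⁻¹ • ContinuousLinearMap.id ℝ (EuclideanSpace ℝ (Fin 2))) y :=
      ((hasFDerivAt_id y).sub_const c).const_smul ε⁻¹
    have hd := (((b.contDiff (n := 1)).differentiable one_ne_zero) (ε⁻¹ • (y - c))).hasFDerivAt.comp y h1
    rw [show (fun y : EuclideanSpace ℝ (Fin 2) => b (ε⁻¹ • (y - c))) =
      ((b : EuclideanSpace ℝ (Fin 2) → ℝ) ∘ fun y => ε⁻¹ • (y - c)) from rfl, hd.fderiv]
    calc ‖(fderiv ℝ (b : EuclideanSpace ℝ (Fin 2) → ℝ) (ε⁻¹ • (y - c))).comp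
          (ε⁻¹ • ContinuousLinearMap.id ℝ (EuclideanSpace ℝ (Fin 2)))‖
        ≤ ‖fderiv ℝ (b : EuclideanSpace ℝ (Fin 2) → ℝ) (ε⁻¹ • (y - c))‖ *
            ‖ε⁻¹ • ContinuousLinearMap.id ℝ (EuclideanSpace ℝ (Fin 2))‖ :=
          ContinuousLinearMap.opNorm_comp_le _ _
      _ ≤ K * ε⁻¹ := by
          refine mul_le_mul (hK _) ?_ (norm_nonneg _) hK0
          rw [norm_smul, norm_inv, Real.norm_of_nonneg hε.le]
          exact mul_le_of_le_one_right (inv_nonneg.2 hε.le) ContinuousLinearMap.norm_id_le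
      _ = K / ε := (div_eq_mul_inv K ε).symm

/-- The shrinking balls `B(c, r₀/(n+1))` are antitone with null intersection. [folklore] -/
theorem antitone_ball_div (c : EuclideanSpace ℝ (Fin 2)) {r₀ : ℝ} (hr₀ : 0 < r₀) :
    Antitone (fun n : ℕ => ball c (r₀ / (n + 1))) ∧
      volume (⋂ n : ℕ, ball c (r₀ / ((n : ℝ) + 1))) = 0 := by
  refine ⟨fun m n hmn => ball_subset_ball ?_, ?_⟩
  · exact div_le_div_of_nonneg_left hr₀.le (by positivity) (by exact_mod_cast Nat.succ_le_succ hmn)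
  · have hsub : (⋂ n : ℕ, ball c (r₀ / ((n : ℝ) + 1))) ⊆ {c} := by
      intro y hy
      rw [mem_iInter] at hy
      by_contra hyc
      have hpos : 0 < dist y c := dist_pos.2 hyc
      obtain ⟨n, hn⟩ := exists_nat_gt (r₀ / dist y c)
      have h := mem_ball.1 (hy n)
      rw [lt_div_iff₀ (by positivity)] at h
      rw [div_lt_iff₀ hpos] at hn
      nlinarith
    exact measure_mono_null hsub (measure_singleton c)

/-- Cauchy–Schwarz for real integrands on the plane, with absolute value:
`|∫ f g| ≤ √(∫ f²) √(∫ g²)` (`L²` data). [folklore] -/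
theorem abs_integral_mul_le_sqrt {ν : Measure (EuclideanSpace ℝ (Fin 2))}
    {f g : EuclideanSpace ℝ (Fin 2) → ℝ} (hf : MemLp f 2 ν) (hg : MemLp g 2 ν) :
    |∫ y, f y * g y ∂ν| ≤ Real.sqrt (∫ y, f y ^ 2 ∂ν) * Real.sqrt (∫ y, g y ^ 2 ∂ν) := by
  have h1 : |∫ y, f y * g y ∂ν| ≤ ∫ y, ‖f y‖ * ‖g y‖ ∂ν := by
    calc |∫ y, f y * g y ∂ν| = ‖∫ y, f y * g y ∂ν‖ := (Real.norm_eq_abs _).symm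
      _ ≤ ∫ y, ‖f y * g y‖ ∂ν := norm_integral_le_integral_norm _
      _ = ∫ y, ‖f y‖ * ‖g y‖ ∂ν := by simp_rw [norm_mul]
  have hf' : MemLp f (ENNReal.ofReal 2) ν := by simpa using hf
  have hg' : MemLp g (ENNReal.ofReal 2) ν := by simpa using hg
  have h2 := integral_mul_norm_le_Lp_mul_Lq Real.HolderConjugate.two_two hf' hg'
  refine h1.trans (h2.trans_eq ?_)
  simp_rw [Real.rpow_two, Real.norm_eq_abs, sq_abs, Real.sqrt_eq_rpow]

/-- **First vanishing lemma**: `∫ κ_n · g → 0` if `|κ_n| ≤ C`, `κ_n` is continuous and vanishes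
off `B(c, r₀/(n+1))`, and `g` is integrable on `B(c, r₀)`. [folklore] -/
theorem tendsto_integral_cutoff_mul {c : EuclideanSpace ℝ (Fin 2)} {r₀ C : ℝ} (hr₀ : 0 < r₀)
    {κ : ℕ → EuclideanSpace ℝ (Fin 2) → ℝ} (hκC : ∀ n y, |κ n y| ≤ C)
    (hκ0 : ∀ (n : ℕ) y, r₀ / (n + 1) ≤ dist y c → κ n y = 0)
    {g : EuclideanSpace ℝ (Fin 2) → ℝ} (hg : IntegrableOn g (ball c r₀)) :
    Tendsto (fun n => ∫ y, κ n y * g y) atTop (𝓝 0) := by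
  obtain ⟨hanti, hnull⟩ := antitone_ball_div c hr₀
  have hsub : ∀ n : ℕ, ball c (r₀ / (n + 1)) ⊆ ball c r₀ := fun n =>
    ball_subset_ball (div_le_self hr₀.le (by linarith [n.cast_nonneg (α := ℝ)]))
  have hgC : IntegrableOn (fun y => C * |g y|) (ball c r₀) := hg.abs.const_mul C
  have hlim : Tendsto (fun n : ℕ => ∫ y in ball c (r₀ / (n + 1)), C * |g y|) atTop (𝓝 0) := by
    have h := tendsto_setIntegral_of_antitone (μ := volume) (f := fun y => C * |g y|)
      (fun n => measurableSet_ball) hanti ⟨0, hgC.mono_set (hsub 0)⟩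
    rwa [setIntegral_measure_zero _ hnull] at h
  rw [tendsto_zero_iff_norm_tendsto_zero]
  refine squeeze_zero (fun n => norm_nonneg _) (fun n => ?_) hlim
  rw [← integral_indicator measurableSet_ball]
  refine norm_integral_le_of_norm_le ((hgC.mono_set (hsub n)).integrable_indicator
    measurableSet_ball) (Eventually.of_forall fun y => ?_)
  by_cases hy : y ∈ ball c (r₀ / (n + 1))
  · rw [indicator_of_mem hy, norm_mul, Real.norm_eq_abs, Real.norm_eq_abs]
    exact mul_le_mul_of_nonneg_right (hκC n y) (abs_nonneg _)
  · rw [indicator_of_notMem hy, hκ0 n y (not_lt.1 fun h => hy (mem_ball.2 h)), zero_mul, norm_zero]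

/-- **Second vanishing lemma** (the planar scale invariance): `∫ κ_n · h → 0` if
`|κ_n| ≤ C (n+1) / r₀`, `κ_n` is continuous and vanishes off `B(c, r₀/(n+1))`, and `h²` is integrable
on `B(c, r₀)` — by Cauchy–Schwarz, `‖κ_n‖_{L²}² ≤ C² |B(0,1)|` uniformly in `n` while
`‖h‖_{L²(B(c, r₀/(n+1)))} → 0`. [folklore] -/
theorem tendsto_integral_cutoffDeriv_mul {c : EuclideanSpace ℝ (Fin 2)} {r₀ C : ℝ} (hr₀ : 0 < r₀)
    {κ : ℕ → EuclideanSpace ℝ (Fin 2) → ℝ} (hκc : ∀ n, Continuous (κ n))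
    (hκC : ∀ (n : ℕ) y, |κ n y| ≤ C * (n + 1) / r₀)
    (hκ0 : ∀ (n : ℕ) y, r₀ / (n + 1) ≤ dist y c → κ n y = 0)
    {h : EuclideanSpace ℝ (Fin 2) → ℝ} (hhm : AEStronglyMeasurable h volume)
    (hh : IntegrableOn (fun y => h y ^ 2) (ball c r₀)) :
    Tendsto (fun n => ∫ y, κ n y * h y) atTop (𝓝 0) := by
  obtain ⟨hanti, hnull⟩ := antitone_ball_div c hr₀
  have hsub : ∀ n : ℕ, ball c (r₀ / (n + 1)) ⊆ ball c r₀ := fun n =>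
    ball_subset_ball (div_le_self hr₀.le (by linarith [n.cast_nonneg (α := ℝ)]))
  set I : ℕ → ℝ := fun n => ∫ y in ball c (r₀ / (n + 1)), h y ^ 2 with hI
  have hIlim : Tendsto I atTop (𝓝 0) := by
    have h := tendsto_setIntegral_of_antitone (μ := volume) (f := fun y => h y ^ 2)
      (fun n => measurableSet_ball) hanti ⟨0, hh.mono_set (hsub 0)⟩
    rwa [setIntegral_measure_zero _ hnull] at h
  set V : ℝ := (volume (ball (0 : EuclideanSpace ℝ (Fin 2)) 1)).toReal with hV
  -- uniform `L²` bound of the cut-off derivatives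
  have hκ2 : ∀ n : ℕ, ∫ y in ball c (r₀ / (n + 1)), κ n y ^ 2 ≤ C ^ 2 * V := by
    intro n
    have hεn : 0 < r₀ / (n + 1) := by positivity
    have hfin : volume (ball c (r₀ / ((n : ℝ) + 1))) < ⊤ := measure_ball_lt_top
    calc ∫ y in ball c (r₀ / (n + 1)), κ n y ^ 2
        ≤ ∫ y in ball c (r₀ / (n + 1)), (C * (n + 1) / r₀) ^ 2 := by
          refine setIntegral_mono_on ?_ (integrableOn_const hfin.ne) measurableSet_ball fun y _ => ?_
          · exact (((hκc n).pow 2).continuousOn.integrableOn_compact (isCompact_closedBall c _)).mono_set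
              ball_subset_closedBall
          · calc κ n y ^ 2 = |κ n y| ^ 2 := (sq_abs _).symm
              _ ≤ (C * (n + 1) / r₀) ^ 2 := pow_le_pow_left₀ (abs_nonneg _) (hκC n y) 2
      _ = (C * (n + 1) / r₀) ^ 2 * (volume (ball c (r₀ / (n + 1)))).toReal := by
          rw [setIntegral_const, smul_eq_mul, mul_comm, measureReal_def]
      _ = C ^ 2 * V := by
          rw [Measure.addHaar_ball_of_pos volume c hεn, finrank_euclideanSpace, Fintype.card_fin,
            ENNReal.toReal_mul, ENNReal.toReal_ofReal (by positivity), hV]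
          field_simp
  -- Cauchy–Schwarz on the `n`-th ball
  have hCS : ∀ n : ℕ, |∫ y, κ n y * h y| ≤ Real.sqrt (C ^ 2 * V) * Real.sqrt (I n) := by
    intro n
    haveI : IsFiniteMeasure (volume.restrict (ball c (r₀ / ((n : ℝ) + 1)))) :=
      isFiniteMeasure_restrict.2 measure_ball_lt_top.ne
    have heq : ∫ y, κ n y * h y = ∫ y in ball c (r₀ / (n + 1)), κ n y * h y := by
      rw [← integral_indicator measurableSet_ball]
      refine integral_congr_ae (Eventually.of_forall fun y => ?_)
      by_cases hy : y ∈ ball c (r₀ / (n + 1))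
      · rw [indicator_of_mem hy]
      · rw [indicator_of_notMem hy]
        simp only [hκ0 n y (not_lt.1 fun h => hy (mem_ball.2 h)), zero_mul]
    rw [heq]
    have hκm : MemLp (κ n) 2 (volume.restrict (ball c (r₀ / (n + 1)))) :=
      (memLp_top_of_bound (hκc n).aestronglyMeasurable (C * (n + 1) / r₀)
        (Eventually.of_forall fun y => by rw [Real.norm_eq_abs]; exact hκC n y)).mono_exponent le_top
    have hhm2 : MemLp h 2 (volume.restrict (ball c (r₀ / (n + 1)))) :=
      (memLp_two_iff_integrable_sq hhm.restrict).2 (hh.mono_set (hsub n))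
    refine (abs_integral_mul_le_sqrt hκm hhm2).trans ?_
    gcongr
    exact hκ2 n
  have hlim : Tendsto (fun n => Real.sqrt (C ^ 2 * V) * Real.sqrt (I n)) atTop (𝓝 0) := by
    have := (hIlim.sqrt).const_mul (Real.sqrt (C ^ 2 * V))
    rwa [Real.sqrt_zero, mul_zero] at this
  rw [tendsto_zero_iff_norm_tendsto_zero]
  exact squeeze_zero (fun n => norm_nonneg _) (fun n => by rw [Real.norm_eq_abs]; exact hCS n) hlim

/-! ## §2 Small letters for the extension across the pole -/

/-- `‖L‖ ≤ Σ_k |L e_k|` for a linear functional on the plane. [folklore] -/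
theorem norm_clm_le_sum_abs_apply (L : EuclideanSpace ℝ (Fin 2) →L[ℝ] ℝ) :
    ‖L‖ ≤ ∑ k : Fin 2, |L (EuclideanSpace.single k 1)| := by
  refine ContinuousLinearMap.opNorm_le_bound _ (Finset.sum_nonneg fun k _ => abs_nonneg _) fun v => ?_
  rw [clm_apply_eq_sum L v, Finset.sum_mul]
  refine (norm_sum_le _ _).trans (Finset.sum_le_sum fun k _ => ?_)
  rw [smul_eq_mul, norm_mul, Real.norm_eq_abs, Real.norm_eq_abs, mul_comm]
  exact mul_le_mul_of_nonneg_left (by simpa using PiLp.norm_apply_le v k) (abs_nonneg _)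

/-- From `Σ_k (G e_k)²` integrable on a ball: each `y ↦ G y v` is integrable there, and so is `G`
(operator norm), given measurability. [folklore] -/
theorem integrableOn_of_energy {c : EuclideanSpace ℝ (Fin 2)} {r₀ : ℝ}
    {G : EuclideanSpace ℝ (Fin 2) → EuclideanSpace ℝ (Fin 2) →L[ℝ] ℝ} (hGm : AEStronglyMeasurable G volume)
    (hG2 : IntegrableOn (fun y => ∑ k : Fin 2, (G y (EuclideanSpace.single k 1)) ^ 2) (ball c r₀)) :
    IntegrableOn G (ball c r₀) ∧ ∀ v : EuclideanSpace ℝ (Fin 2), IntegrableOn (fun y => G y v) (ball c r₀) := by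
  haveI : IsFiniteMeasure (volume.restrict (ball c r₀)) := isFiniteMeasure_restrict.2 measure_ball_lt_top.ne
  have hk : ∀ k : Fin 2, IntegrableOn (fun y => |G y (EuclideanSpace.single k 1)|) (ball c r₀) := by
    intro k
    have hm : AEStronglyMeasurable (fun y => G y (EuclideanSpace.single k 1)) (volume.restrict (ball c r₀)) :=
      (ContinuousLinearMap.apply ℝ ℝ (EuclideanSpace.single k (1 : ℝ))).continuous.comp_aestronglyMeasurable
        hGm.restrict
    have h2 : MemLp (fun y => G y (EuclideanSpace.single k 1)) 2 (volume.restrict (ball c r₀)) := by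
      refine (memLp_two_iff_integrable_sq hm).2 (hG2.mono' ((continuous_pow 2).comp_aestronglyMeasurable hm)
        (Eventually.of_forall fun y => ?_))
      rw [Real.norm_eq_abs, abs_of_nonneg (sq_nonneg _)]
      exact Finset.single_le_sum (f := fun k => (G y (EuclideanSpace.single k 1)) ^ 2)
        (fun i _ => sq_nonneg _) (Finset.mem_univ k)
    exact (h2.integrable one_le_two).abs
  have hsum : IntegrableOn (fun y => ∑ k : Fin 2, |G y (EuclideanSpace.single k 1)|) (ball c r₀) :=
    integrable_finsetSum _ fun k _ => hk k
  have hG : IntegrableOn G (ball c r₀) :=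
    Integrable.mono' hsum hGm.restrict (Eventually.of_forall fun y => norm_clm_le_sum_abs_apply (G y))
  exact ⟨hG, fun v => (ContinuousLinearMap.apply ℝ ℝ v).integrable_comp hG⟩

/-- A test function times `1 − χ`, with `χ = 1` near `c`, is a test function off the pole. [folklore] -/
theorem isTestFunctionOn_mul_one_sub {c : EuclideanSpace ℝ (Fin 2)} {φ χ : EuclideanSpace ℝ (Fin 2) → ℝ}
    (hφ : ContDiff ℝ ∞ φ) (hφs : HasCompactSupport φ) (hχ : ContDiff ℝ ∞ χ) {ε : ℝ} (hε : 0 < ε)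
    (h1 : ∀ y, dist y c ≤ ε → χ y = 1) :
    IsTestFunctionOn ⟨{c}ᶜ, isOpen_compl_singleton⟩ (fun y => φ y * (1 - χ y)) := by
  refine ⟨hφ.mul (contDiff_const.sub hχ), hφs.mul_right, fun y hy hyc => ?_⟩
  have hyc' : y = c := hyc
  subst hyc'
  have h0 : (fun y => φ y * (1 - χ y)) =ᶠ[𝓝 y] fun _ => 0 := by
    filter_upwards [Metric.ball_mem_nhds y hε] with z hz
    rw [h1 z (mem_ball.1 hz).le, sub_self, mul_zero]
  exact (notMem_tsupport_iff_eventuallyEq.2 h0) hy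

end Summit.QuantumFields.YangMills.Theorems.PoincareLipschitzSobolevInversion

end
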